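import Summits.Ventures.PercRepro.RankLevelSetDepCountGiantB

/-!
# PercRepro — THE `U`-COUNT WITH THE BIG CLASS SPLIT AT THE UNIQUE GIANT FLAT — PART B2: THE COUNTS (p8, S3)

Continues `RankLevelSetDepCountGiantB` (the giant pairs `pairsGiant` / the mid pairs `pairsMid` and the uniqueness
`closure_eq_of_giant`): `card_pairsGiant_le` (all giant pairs lie inside the one giant flat of `≤ min(f, q + d)`
points), the mid / giant fibre bounds, the level-`m` count `mul_card_levelF_le_giant`, and the final
**`ncard_eRk_eq_ncard_le_le_giant`** (in `ℚ`):
`#{B ⊆ E : r(B) = q, |B| ≤ d} ≤ C(n, q) + σ(f′ − q)·P_E + σ(min(f − q − 1, ν₁ − 2))·P_{S₀} + σ(F_max − q − 1)·P_{F_max}`,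
`σ(m) = Σ_{j ≤ d−q−1} C(m, j)/(j + 1)`, `P_S = Σ_k s_k·C(|S|, q + 1 − k)`, `F_max = min(f, q + d)`.
Axioms: standard.
-/

open scoped Matroid

namespace PercRepro

namespace Matroid

open Set Finset

variable {α : Type} {M : _root_.Matroid α}

open scoped Classical in
/-- **The giant pairs number at most `Σ_k s_k·C(F_max, q + 1 − k)`**, `F_max = min(f, q + d)`: they all lie inside the
one giant flat. -/
theorem card_pairsGiant_le [M.Finite] {q f f' ν₁ νi : ℕ} (hq : 1 ≤ q)
    (hflat : ∀ X ⊆ M.E, M.eRk X ≤ q → X.ncard ≤ f)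
    (hflat' : ∀ X ⊆ M.E, M.eRk X ≤ (q - 1 : ℕ) → X.ncard ≤ f')
    (hinter : ∀ X ⊆ M.E, M.eRk X ≤ (q - 1 : ℕ) → (X.ncard : ℕ∞) ≤ M.eRk X + νi)
    {d : ℕ} (hd : M.E.encard = M.eRank + d) (h2 : d + νi < 2 * ν₁) :
    (pairsGiant M q f' ν₁).card ≤
      ∑ k ∈ Finset.Icc 3 (q + 1), {C | M.IsCircuit C ∧ C.ncard = k}.ncard * (min f (q + d)).choose (q + 1 - k) := by
  rcases (pairsGiant M q f' ν₁).eq_empty_or_nonempty with hemp | ⟨p₀, hp₀⟩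
  · rw [hemp, Finset.card_empty]; exact Nat.zero_le _
  set F := M.closure (p₀.1 ∪ p₀.2) with hF
  have hFE : F ⊆ M.E := M.closure_subset_ground _
  have hFfin : F.Finite := M.ground_finite.subset hFE
  set Ff := hFfin.toFinset with hFf
  have hFcard : Ff.card ≤ min f (q + d) := by
    rw [hFf, ← Set.ncard_eq_toFinset_card _ hFfin]
    apply le_min
    · exact hflat F hFE (by
        have := pairsF_data (Finset.mem_filter.1 (Finset.mem_filter.1 hp₀).1).1
        rw [hF, M.eRk_closure_eq]; exact this.2.2.2.1)
    · obtain ⟨r, hr⟩ := exists_eRk_eq_nat (M := M) hFE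
      have hcap := encard_le_eRk_add_of_encard_eq (M := M) hFE hd
      rw [hr, ← hFfin.cast_ncard_eq] at hcap
      have hcap' : F.ncard ≤ r + d := by exact_mod_cast hcap
      have hrq : r ≤ q := by
        have := pairsF_data (Finset.mem_filter.1 (Finset.mem_filter.1 hp₀).1).1
        have h := this.2.2.2.1
        rw [← M.eRk_closure_eq, ← hF, hr] at h
        exact_mod_cast h
      omega
  have hsub : pairsGiant M q f' ν₁ ⊆
      (Finset.Icc 3 (q + 1)).biUnion (fun k => circF M k ×ˢ subsF Ff (q + 1 - k)) := by
    intro p hp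
    have hcl : M.closure (p.1 ∪ p.2) = F := closure_eq_of_giant hq hflat' hinter hd h2 hp hp₀
    obtain ⟨hp1E, hp2E, hU, hrk, k, hk, h1, hp2c⟩ :=
      pairsF_data (Finset.mem_filter.1 (Finset.mem_filter.1 hp).1).1
    have hUE : p.1 ∪ p.2 ⊆ M.E := union_subset hp1E hp2E
    have hUF : p.1 ∪ p.2 ⊆ F := by rw [← hcl]; exact M.subset_closure _ hUE
    rw [Finset.mem_biUnion]
    refine ⟨k, hk, ?_⟩
    rw [Finset.mem_product]
    refine ⟨h1, mem_subsF_of ?_ hp2c⟩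
    rw [hFf, Set.Finite.coe_toFinset]
    exact subset_union_right.trans hUF
  calc (pairsGiant M q f' ν₁).card
      ≤ ((Finset.Icc 3 (q + 1)).biUnion (fun k => circF M k ×ˢ subsF Ff (q + 1 - k))).card :=
        Finset.card_le_card hsub
    _ ≤ ∑ k ∈ Finset.Icc 3 (q + 1), (circF M k ×ˢ subsF Ff (q + 1 - k)).card := Finset.card_biUnion_le
    _ ≤ _ := by
        apply Finset.sum_le_sum
        intro k _
        rw [Finset.card_product, card_circF]
        exact Nat.mul_le_mul_left _ ((card_subsF_le _ _).trans (Nat.choose_le_choose _ hFcard))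

open scoped Classical in
/-- The fibre bound at one level for a MID pair: `≤ C(min(f − (q + 1), ν₁ − 2), m − q − 1)`. -/
theorem card_fibreLevel_mid [M.Finite] (q f f' ν₁ : ℕ) (hflat : ∀ X ⊆ M.E, M.eRk X ≤ q → X.ncard ≤ f)
    {p : Set α × Set α} (hp : p ∈ pairsMid M q f' ν₁) (m : ℕ) :
    (fibreLevel M q p m).card ≤ (min (f - (q + 1)) (ν₁ - 2)).choose (m - (q + 1)) := by
  unfold pairsMid at hp
  rw [Finset.mem_filter] at hp
  obtain ⟨hpB, hmid⟩ := hp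
  push Not at hmid
  have hpP : p ∈ pairsF M q := (Finset.mem_filter.1 hpB).1
  obtain ⟨hp1E, hp2E, hU, hrk, -⟩ := pairsF_data hpP
  have hUE : p.1 ∪ p.2 ⊆ M.E := union_subset hp1E hp2E
  have hFfin : (M.closure (p.1 ∪ p.2)).Finite := M.ground_finite.subset (M.closure_subset_ground _)
  have hUF : p.1 ∪ p.2 ⊆ M.closure (p.1 ∪ p.2) := M.subset_closure _ hUE
  have hFf : (M.closure (p.1 ∪ p.2)).ncard ≤ f :=
    hflat _ (M.closure_subset_ground _) (by rw [M.eRk_closure_eq]; exact hrk)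
  have hFU : (M.closure (p.1 ∪ p.2) \ (p.1 ∪ p.2)).ncard ≤ min (f - (q + 1)) (ν₁ - 2) := by
    rw [ncard_sdiff hUF (hFfin.subset hUF), hU]
    omega
  exact (card_fibreLevel_le_choose q hpP m).trans (Nat.choose_le_choose _ hFU)

open scoped Classical in
/-- The fibre bound at one level for a GIANT pair: `≤ C(min(f, q + d) − (q + 1), m − q − 1)`. -/
theorem card_fibreLevel_giant [M.Finite] (q f f' ν₁ : ℕ) (hflat : ∀ X ⊆ M.E, M.eRk X ≤ q → X.ncard ≤ f)
    {d : ℕ} (hd : M.E.encard = M.eRank + d) {p : Set α × Set α} (hp : p ∈ pairsGiant M q f' ν₁) (m : ℕ) :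
    (fibreLevel M q p m).card ≤ (min f (q + d) - (q + 1)).choose (m - (q + 1)) := by
  have hpP : p ∈ pairsF M q := (Finset.mem_filter.1 (Finset.mem_filter.1 hp).1).1
  obtain ⟨hp1E, hp2E, hU, hrk, -⟩ := pairsF_data hpP
  have hUE : p.1 ∪ p.2 ⊆ M.E := union_subset hp1E hp2E
  set F := M.closure (p.1 ∪ p.2) with hF
  have hFE : F ⊆ M.E := M.closure_subset_ground _
  have hFfin : F.Finite := M.ground_finite.subset hFE
  have hUF : p.1 ∪ p.2 ⊆ F := M.subset_closure _ hUE
  have hFf : F.ncard ≤ f := hflat F hFE (by rw [hF, M.eRk_closure_eq]; exact hrk)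
  have hFd : F.ncard ≤ q + d := by
    obtain ⟨r, hr⟩ := exists_eRk_eq_nat (M := M) hFE
    have hcap := encard_le_eRk_add_of_encard_eq (M := M) hFE hd
    rw [hr, ← hFfin.cast_ncard_eq] at hcap
    have hcap' : F.ncard ≤ r + d := by exact_mod_cast hcap
    have hrq : r ≤ q := by
      have h := hrk
      rw [← M.eRk_closure_eq, ← hF, hr] at h
      exact_mod_cast h
    omega
  have hFU : (F \ (p.1 ∪ p.2)).ncard ≤ min f (q + d) - (q + 1) := by
    rw [ncard_sdiff hUF (hFfin.subset hUF), hU]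
    omega
  exact (card_fibreLevel_le_choose q hpP m).trans (Nat.choose_le_choose _ hFU)

open scoped Classical in
/-- **The level-`m` count with the giant split.** -/
theorem mul_card_levelF_le_giant [M.Finite] (q f f' ν₁ : ℕ) (hcirc : ∀ C, M.IsCircuit C → 3 ≤ C.encard)
    (hflat : ∀ X ⊆ M.E, M.eRk X ≤ q → X.ncard ≤ f) {d : ℕ} (hd : M.E.encard = M.eRank + d) (m : ℕ) :
    (m - q) * (levelF M q m).card ≤
      (pairsSmall M q f').card * (f' - q).choose (m - (q + 1)) +
        (pairsMid M q f' ν₁).card * (min (f - (q + 1)) (ν₁ - 2)).choose (m - (q + 1)) +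
        (pairsGiant M q f' ν₁).card * (min f (q + d) - (q + 1)).choose (m - (q + 1)) := by
  have hsplit : ∑ p ∈ pairsF M q, (fibreLevel M q p m).card =
      ∑ p ∈ pairsSmall M q f', (fibreLevel M q p m).card + ∑ p ∈ pairsBig M q f', (fibreLevel M q p m).card := by
    unfold pairsSmall pairsBig
    exact (Finset.sum_filter_add_sum_filter_not (pairsF M q) _ _).symm
  have hsplit2 : ∑ p ∈ pairsBig M q f', (fibreLevel M q p m).card =
      ∑ p ∈ pairsGiant M q f' ν₁, (fibreLevel M q p m).card +
        ∑ p ∈ pairsMid M q f' ν₁, (fibreLevel M q p m).card := by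
    unfold pairsGiant pairsMid
    exact (Finset.sum_filter_add_sum_filter_not (pairsBig M q f') _ _).symm
  calc (m - q) * (levelF M q m).card ≤ ∑ p ∈ pairsF M q, (fibreLevel M q p m).card :=
        mul_card_levelF_le_sum q hcirc m
    _ = ∑ p ∈ pairsSmall M q f', (fibreLevel M q p m).card +
          (∑ p ∈ pairsGiant M q f' ν₁, (fibreLevel M q p m).card +
            ∑ p ∈ pairsMid M q f' ν₁, (fibreLevel M q p m).card) := by rw [hsplit, hsplit2]
    _ ≤ ∑ _p ∈ pairsSmall M q f', (f' - q).choose (m - (q + 1)) +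
          (∑ _p ∈ pairsGiant M q f' ν₁, (min f (q + d) - (q + 1)).choose (m - (q + 1)) +
            ∑ _p ∈ pairsMid M q f' ν₁, (min (f - (q + 1)) (ν₁ - 2)).choose (m - (q + 1))) := by
        gcongr with p hp p hp p hp
        · exact card_fibreLevel_small q f' hp m
        · exact card_fibreLevel_giant q f f' ν₁ hflat hd hp m
        · exact card_fibreLevel_mid q f f' ν₁ hflat hp m
    _ = _ := by
        simp only [Finset.sum_const, smul_eq_mul]
        ring

open scoped Classical in
/-- **THE RANK-`q` SETS OF AT MOST `d` ELEMENTS, WITH THE GIANT FLAT SPLIT OFF** (in `ℚ`): with every circuit of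
`≥ 3` elements, every set of rank `≤ q` of `≤ f` points, every set of rank `≤ q − 1` of `≤ f′` points and of nullity
`≤ ν_∩`, `|E| = r(M) + d`, and `d + ν_∩ < 2ν₁`:
`#{B ⊆ E : r(B) = q, |B| ≤ d} ≤ C(n, q) + σ(f′ − q)·P_E + σ(min(f − q − 1, ν₁ − 2))·P_{S₀} + σ(F_max − q − 1)·P_{F_max}` with
`σ(m) = Σ_{j ≤ d−q−1} C(m, j)/(j + 1)`, `P_S = Σ_k s_k·C(S, q+1−k)`, `F_max = min(f, q + d)`. -/
theorem ncard_eRk_eq_ncard_le_le_giant (M : _root_.Matroid α) [M.Finite] (q f f' ν₁ νi : ℕ) (hq : 1 ≤ q)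
    (hcirc : ∀ C, M.IsCircuit C → 3 ≤ C.encard)
    (hflat : ∀ X ⊆ M.E, M.eRk X ≤ q → X.ncard ≤ f)
    (hflat' : ∀ X ⊆ M.E, M.eRk X ≤ (q - 1 : ℕ) → X.ncard ≤ f')
    (hinter : ∀ X ⊆ M.E, M.eRk X ≤ (q - 1 : ℕ) → (X.ncard : ℕ∞) ≤ M.eRk X + νi)
    {d : ℕ} (hd : M.E.encard = M.eRank + d) (h2 : d + νi < 2 * ν₁) :
    ({B : Set α | B ⊆ M.E ∧ M.eRk B = q ∧ B.ncard ≤ d}.ncard : ℚ) ≤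
      (M.E.ncard.choose q : ℚ) +
        (∑ j ∈ Finset.range (d - (q + 1) + 1), ((f' - q).choose j : ℚ) / (j + 1)) *
          (∑ k ∈ Finset.Icc 3 (q + 1),
            ({C | M.IsCircuit C ∧ C.ncard = k}.ncard : ℚ) * (M.E.ncard.choose (q + 1 - k) : ℚ)) +
        (∑ j ∈ Finset.range (d - (q + 1) + 1), ((min (f - (q + 1)) (ν₁ - 2)).choose j : ℚ) / (j + 1)) *
          (∑ k ∈ Finset.Icc 3 (q + 1),
            ({C | M.IsCircuit C ∧ C.ncard = k}.ncard : ℚ) * (((q + 1) * d).choose (q + 1 - k) : ℚ)) +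
        (∑ j ∈ Finset.range (d - (q + 1) + 1), ((min f (q + d) - (q + 1)).choose j : ℚ) / (j + 1)) *
          (∑ k ∈ Finset.Icc 3 (q + 1),
            ({C | M.IsCircuit C ∧ C.ncard = k}.ncard : ℚ) * ((min f (q + d)).choose (q + 1 - k) : ℚ)) := by
  set Ef := groundF M with hEf
  have hE : (Ef : Set α) = M.E := coe_groundF M
  have hEcard : Ef.card = M.E.ncard := card_groundF M
  set S := {B : Set α | B ⊆ M.E ∧ M.eRk B = q ∧ B.ncard ≤ d} with hS
  set S₁ := {B : Set α | B ⊆ (Ef : Set α) ∧ B.ncard = q} with hS₁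
  set S₂ := {B : Set α | B ⊆ M.E ∧ M.eRk B = q ∧ q < B.ncard ∧ B.ncard ≤ d} with hS₂
  have hsplit : S ⊆ S₁ ∪ S₂ := by
    intro B hB
    have hBfin : B.Finite := M.ground_finite.subset hB.1
    have hle : q ≤ B.ncard := by
      have := M.eRk_le_encard B
      rw [hB.2.1, ← hBfin.cast_ncard_eq] at this
      exact_mod_cast this
    rcases hle.lt_or_eq with h | h
    · exact Or.inr ⟨hB.1, hB.2.1, h, hB.2.2⟩
    · exact Or.inl ⟨by rw [hE]; exact hB.1, h.symm⟩
  have hS₁fin : S₁.Finite := (Ef.finite_toSet.finite_subsets).subset (fun B hB => hB.1)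
  have hS₂fin : S₂.Finite := M.ground_finite.finite_subsets.subset (fun B hB => hB.1)
  have hS₁ : S₁.ncard = M.E.ncard.choose q := by
    rw [hS₁, ncard_subsets_ncard_eq Ef q, hEcard]
  set Ps := (pairsSmall M q f').card with hPs
  set Pm := (pairsMid M q f' ν₁).card with hPm
  set Pg := (pairsGiant M q f' ν₁).card with hPg
  set Fm := min f (q + d) with hFm
  have hlevel : ∀ m ∈ Finset.Icc (q + 1) d, ((levelF M q m).card : ℚ) ≤
      ((Ps : ℚ) * ((f' - q).choose (m - (q + 1)) : ℚ) + (Pm : ℚ) * ((min (f - (q + 1)) (ν₁ - 2)).choose (m - (q + 1)) : ℚ) +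
        (Pg : ℚ) * ((Fm - (q + 1)).choose (m - (q + 1)) : ℚ)) / ((m - q : ℕ) : ℚ) := by
    intro m hm
    rw [Finset.mem_Icc] at hm
    have hpos : (0 : ℚ) < ((m - q : ℕ) : ℚ) := by exact_mod_cast (by omega : 0 < m - q)
    rw [le_div_iff₀ hpos]
    have h := mul_card_levelF_le_giant q f f' ν₁ hcirc hflat hd m
    have h' : (((m - q) * (levelF M q m).card : ℕ) : ℚ) ≤
        ((Ps * (f' - q).choose (m - (q + 1)) + Pm * (min (f - (q + 1)) (ν₁ - 2)).choose (m - (q + 1)) +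
          Pg * (Fm - (q + 1)).choose (m - (q + 1)) : ℕ) : ℚ) := by
      exact_mod_cast h
    push_cast at h'
    linarith
  have hS₂q : (S₂.ncard : ℚ) ≤ ∑ m ∈ Finset.Icc (q + 1) d,
      ((Ps : ℚ) * ((f' - q).choose (m - (q + 1)) : ℚ) + (Pm : ℚ) * ((min (f - (q + 1)) (ν₁ - 2)).choose (m - (q + 1)) : ℚ) +
        (Pg : ℚ) * ((Fm - (q + 1)).choose (m - (q + 1)) : ℚ)) / ((m - q : ℕ) : ℚ) := by
    calc (S₂.ncard : ℚ) ≤ ((∑ m ∈ Finset.Icc (q + 1) d, (levelF M q m).card : ℕ) : ℚ) := by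
          exact_mod_cast ncard_dep_le_sum_levelF q d
      _ = ∑ m ∈ Finset.Icc (q + 1) d, ((levelF M q m).card : ℚ) := by push_cast; rfl
      _ ≤ _ := Finset.sum_le_sum hlevel
  have hre : ∑ m ∈ Finset.Icc (q + 1) d,
      ((Ps : ℚ) * ((f' - q).choose (m - (q + 1)) : ℚ) + (Pm : ℚ) * ((min (f - (q + 1)) (ν₁ - 2)).choose (m - (q + 1)) : ℚ) +
        (Pg : ℚ) * ((Fm - (q + 1)).choose (m - (q + 1)) : ℚ)) / ((m - q : ℕ) : ℚ) =
      ∑ j ∈ Finset.range (d - q),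
      ((Ps : ℚ) * ((f' - q).choose j : ℚ) + (Pm : ℚ) * ((min (f - (q + 1)) (ν₁ - 2)).choose j : ℚ) +
        (Pg : ℚ) * ((Fm - (q + 1)).choose j : ℚ)) / ((j : ℚ) + 1) := by
    rw [show Finset.Icc (q + 1) d = Finset.image (fun j => q + 1 + j) (Finset.range (d - q)) from ?_]
    · rw [Finset.sum_image (fun a _ b _ h => by omega)]
      apply Finset.sum_congr rfl
      intro j _
      rw [show q + 1 + j - (q + 1) = j by omega, show q + 1 + j - q = j + 1 by omega]
      push_cast
      ring
    · ext m
      rw [Finset.mem_Icc, Finset.mem_image]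
      constructor
      · intro hm
        exact ⟨m - (q + 1), by rw [Finset.mem_range]; omega, by omega⟩
      · rintro ⟨j, hj, rfl⟩
        rw [Finset.mem_range] at hj
        omega
  have hrange : Finset.range (d - q) ⊆ Finset.range (d - (q + 1) + 1) := Finset.range_mono (by omega)
  have hS₂q' : (S₂.ncard : ℚ) ≤
      (Ps : ℚ) * ∑ j ∈ Finset.range (d - (q + 1) + 1), ((f' - q).choose j : ℚ) / (j + 1) +
      (Pm : ℚ) * ∑ j ∈ Finset.range (d - (q + 1) + 1), ((min (f - (q + 1)) (ν₁ - 2)).choose j : ℚ) / (j + 1) +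
      (Pg : ℚ) * ∑ j ∈ Finset.range (d - (q + 1) + 1), ((Fm - (q + 1)).choose j : ℚ) / (j + 1) := by
    rw [Finset.mul_sum, Finset.mul_sum, Finset.mul_sum, ← Finset.sum_add_distrib, ← Finset.sum_add_distrib]
    refine hS₂q.trans (hre.le.trans ?_)
    refine Finset.sum_le_sum_of_subset_of_nonneg hrange (fun j _ _ => by positivity) |>.trans' ?_
    apply le_of_eq
    apply Finset.sum_congr rfl
    intro j _
    field_simp
  -- the pair counts
  have hPsq : (Ps : ℚ) ≤ ∑ k ∈ Finset.Icc 3 (q + 1),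
      ({C | M.IsCircuit C ∧ C.ncard = k}.ncard : ℚ) * (M.E.ncard.choose (q + 1 - k) : ℚ) := by
    have h1 : Ps ≤ (pairsF M q).card := Finset.card_filter_le _ _
    have h2 := card_pairsF_le (M := M) q
    have : ((Ps : ℕ) : ℚ) ≤ ((∑ k ∈ Finset.Icc 3 (q + 1),
        {C | M.IsCircuit C ∧ C.ncard = k}.ncard * M.E.ncard.choose (q + 1 - k) : ℕ) : ℚ) := by
      exact_mod_cast h1.trans h2
    push_cast at this
    exact this
  have hPmq : (Pm : ℚ) ≤ ∑ k ∈ Finset.Icc 3 (q + 1),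
      ({C | M.IsCircuit C ∧ C.ncard = k}.ncard : ℚ) * (((q + 1) * d).choose (q + 1 - k) : ℚ) := by
    have h1 : Pm ≤ (pairsBig M q f').card := Finset.card_filter_le _ _
    have h2 := card_pairsBig_le (M := M) q f' hq hflat' hd
    have : ((Pm : ℕ) : ℚ) ≤ ((∑ k ∈ Finset.Icc 3 (q + 1),
        {C | M.IsCircuit C ∧ C.ncard = k}.ncard * ((q + 1) * d).choose (q + 1 - k) : ℕ) : ℚ) := by
      exact_mod_cast h1.trans h2
    push_cast at this
    exact this
  have hPgq : (Pg : ℚ) ≤ ∑ k ∈ Finset.Icc 3 (q + 1),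
      ({C | M.IsCircuit C ∧ C.ncard = k}.ncard : ℚ) * (Fm.choose (q + 1 - k) : ℚ) := by
    have h2 := card_pairsGiant_le (M := M) (ν₁ := ν₁) hq hflat hflat' hinter hd h2
    have : ((Pg : ℕ) : ℚ) ≤ ((∑ k ∈ Finset.Icc 3 (q + 1),
        {C | M.IsCircuit C ∧ C.ncard = k}.ncard * Fm.choose (q + 1 - k) : ℕ) : ℚ) := by
      exact_mod_cast h2
    push_cast at this
    exact this
  have hσs0 : (0 : ℚ) ≤ ∑ j ∈ Finset.range (d - (q + 1) + 1), ((f' - q).choose j : ℚ) / (j + 1) :=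
    Finset.sum_nonneg (fun j _ => by positivity)
  have hσm0 : (0 : ℚ) ≤ ∑ j ∈ Finset.range (d - (q + 1) + 1), ((min (f - (q + 1)) (ν₁ - 2)).choose j : ℚ) / (j + 1) :=
    Finset.sum_nonneg (fun j _ => by positivity)
  have hσg0 : (0 : ℚ) ≤ ∑ j ∈ Finset.range (d - (q + 1) + 1), ((Fm - (q + 1)).choose j : ℚ) / (j + 1) :=
    Finset.sum_nonneg (fun j _ => by positivity)
  have hSq : (S.ncard : ℚ) ≤ (S₁.ncard : ℚ) + (S₂.ncard : ℚ) := by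
    have : S.ncard ≤ S₁.ncard + S₂.ncard :=
      (ncard_le_ncard hsplit (hS₁fin.union hS₂fin)).trans (ncard_union_le _ _)
    exact_mod_cast this
  rw [hS₁] at hSq
  have e1 := mul_le_mul_of_nonneg_right hPsq hσs0
  have e2 := mul_le_mul_of_nonneg_right hPmq hσm0
  have e3 := mul_le_mul_of_nonneg_right hPgq hσg0
  calc (S.ncard : ℚ) ≤ (M.E.ncard.choose q : ℚ) + (S₂.ncard : ℚ) := hSq
    _ ≤ _ := by linarith [hS₂q', e1, e2, e3]

end Matroid

end PercRepro
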